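import Summits.AtomisticToContinuum.BoseEinsteinCondensation.Theorems.BECGroundStateSOSLatticeODLROOffHalfFillingLadderGlue
import Summits.AtomisticToContinuum.BoseEinsteinCondensation.Theorems.BECStronglyRayleighSectorGroundStatePerron
import Summits.AtomisticToContinuum.BoseEinsteinCondensation.Theorems.BECGroundStateSOSLatticeODLROOffHalfFillingStubTent
import Summits.AtomisticToContinuum.BoseEinsteinCondensation.Theorems.BECGroundStateSOSLatticeODLROOffHalfFillingStubSectorGround
import Summits.AtomisticToContinuum.BoseEinsteinCondensation.Theorems.BECGroundStateSOSLatticeODLROOffHalfFillingStubAverage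
import Summits.AtomisticToContinuum.BoseEinsteinCondensation.Theorems.BECGroundStateSOSLatticeODLROOffHalfFillingStubAnchor

/-!
# Crux `LatticeODLROOffHalfFilling` — the ladder line, conditional form:
# concavity of the planar moment along the filling ladder ⇒ ODLRO off half filling

Route BECGroundStateSOS, crux stmt-AtomisticToContinuum-11033, line `Sketch` (lead prover). This file proves the
reductions `LatticeODLROOffHalfFilling_of_comparable : (comparability, up to a constant, of the planar moments of the
sector ground states of the XY torus across the middle fillings N ∈ [L³/5, 4L³/5]) → LatticeODLROOffHalfFilling` and
`LatticeODLROOffHalfFilling_of_concave : (concavity of the planar moment along the filling ladder) →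
LatticeODLROOffHalfFilling` (via `comparable_of_concave`, constant ¼), with every other ingredient discharged:

* `stub_tent` (tent bound for concave sequences), `stub_trialEnergy` (`E₀(H_{L,μ}) ≤ −¾L³`), `stub_kineticBound`
  (`H_XY ≥ −3(L³/2 − |S³_tot|)` on sectors), `stub_sectorGround` (ground vectors of `H_{L,μ}` in a sector are sector
  ground vectors), `stub_average` (column bounds ⇒ tracial bound), `stub_anchor` (the in-tree Kennedy–Lieb–Shastry
  theorem as an anchor column) — all landed as separate support files and imported here;
* glue (file `BECGroundStateSOSLatticeODLROOffHalfFillingLadderGlue.lean`): columns of `P₀` are `S³_tot`-eigen ground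
  vectors (`col_facts`), the sector window `|M| ≤ 0.3L³` for `|μ| ≤ ½` (`sector_window`), the a-priori bound `≤ ½` on
  the liminf terms (`orderParam_le_half`); here, Perron–Frobenius uniqueness of sector ground vectors
  (`SectorGroundStatePerron_proof`) makes the planar-moment profile `a_L(N)` a function of `N`.

With `μ₀ = ½`: for large `k` every column of `P₀(H_{2k,μ})` lives in a sector `N ∈ [L³/5, 4L³/5]`, the anchor column in a
sector `N' ∈ [L³/5, 4L³/5]` with `a_L(N') ≥ a₀L⁶`, the tent gives `a_L(N) ≥ a₀L⁶/4`, averaging gives the `k`-th term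
`≥ a₀/4`. The hypothesis (concavity) is the registered stub `stub_concave` of the line; it is a conjecture of the
strength of the crux (see the line's evidence note: it fails on graphs with an incompressible filling, e.g. the
rung-Mott two-leg ladder, so any proof must exclude Mott physics on `(ℤ/Lℤ)³`). All [folklore] except the cited KLS input.
-/

noncomputable section

namespace Summit.AtomisticToContinuum.BoseEinsteinCondensation.Theorems.LatticeODLROOffHalfFilling.Ladder

open Literature.MathematicalPhysics.QuantumLattice Literature.Probability.LatticeModels Matrix Finset
open Summit.AtomisticToContinuum.BoseEinsteinCondensation.Theorems.LatticeODLROOffHalfFilling.Negative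
open scoped ComplexOrder BigOperators


/-! ### The reduction -/

/-- **Comparability of the planar moment across the middle fillings implies ODLRO off half filling.**
If for some `c > 0` and all large even `L` the planar moments `⟨ψ, Oψ⟩/‖ψ‖²` of any two sector ground vectors of the
XY torus in sectors `N, N' ∈ [L³/5, 4L³/5]` compare as `c · a(ψ') ≤ a(ψ)`, then `LatticeODLROOffHalfFilling` holds with
`μ₀ = ½` and liminf bound `c · a₀` (`a₀` the KLS anchor constant): sector window, KLS anchor column, sector ground
vectors and averaging over the columns of `P₀`. This is the exact interface every ladder-shape K1 (concavity, MONO +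
half-filled anchor, LIP + doping cost) has to deliver. [folklore] -/
theorem LatticeODLROOffHalfFilling_of_comparable
    (hcomparable : ∃ c : ℝ, 0 < c ∧ ∃ L₀ : ℕ, ∀ (L : ℕ) [NeZero L], L₀ ≤ L → Even L → ∀ N N' : ℕ,
        (L : ℝ) ^ 3 / 5 ≤ N → (N : ℝ) ≤ 4 / 5 * (L : ℝ) ^ 3 →
        (L : ℝ) ^ 3 / 5 ≤ N' → (N' : ℝ) ≤ 4 / 5 * (L : ℝ) ^ 3 →
        ∀ ψ ψ' : TensorIndex (TorusSite 3 L) 2 → ℂ,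
          ψ ≠ 0 → (totalSpin 1 2 : Op (TorusSite 3 L) 2) *ᵥ ψ =
              (((((N : ℕ) : ℝ) - (L : ℝ) ^ 3 / 2 : ℝ)) : ℂ) • ψ →
            xyTorus 3 L 1 *ᵥ ψ = ((lowestEnergyInSector 1 (xyTorus 3 L 1)
              (((N : ℕ) : ℝ) - (L : ℝ) ^ 3 / 2) : ℝ) : ℂ) • ψ →
          ψ' ≠ 0 → (totalSpin 1 2 : Op (TorusSite 3 L) 2) *ᵥ ψ' =
              (((((N' : ℕ) : ℝ) - (L : ℝ) ^ 3 / 2 : ℝ)) : ℂ) • ψ' →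
            xyTorus 3 L 1 *ᵥ ψ' = ((lowestEnergyInSector 1 (xyTorus 3 L 1)
              (((N' : ℕ) : ℝ) - (L : ℝ) ^ 3 / 2) : ℝ) : ℂ) • ψ' →
          c * ((star ψ' ⬝ᵥ (∑ x : TorusSite 3 L, ∑ y : TorusSite 3 L, hop x y) *ᵥ ψ').re /
              (star ψ' ⬝ᵥ ψ').re) ≤
            (star ψ ⬝ᵥ (∑ x : TorusSite 3 L, ∑ y : TorusSite 3 L, hop x y) *ᵥ ψ).re /
              (star ψ ⬝ᵥ ψ).re) :
    Summit.AtomisticToContinuum.BoseEinsteinCondensation.Theses.BECGroundStateSOS.LatticeODLROOffHalfFilling := by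
  rw [latticeODLRO_iff]
  obtain ⟨c, hc, L₂, hcomp⟩ := hcomparable
  obtain ⟨a₀, ha₀, k₀, hanchor⟩ := stub_anchor
  refine ⟨1 / 2, by norm_num, fun μ hμ => ?_⟩
  have hμ' : |μ| ≤ 1 / 2 := hμ.le
  unfold LROAt
  set f : ℕ → ℝ := fun k : ℕ => (∑ x ∈ halfOpenBox 3 (2 * k), ∑ y ∈ halfOpenBox 3 (2 * k),
    torusPullback (d := 3) (fun L x y => if hL : L = 0 then 0 else (haveI : NeZero L := ⟨hL⟩;
      (∑ α : Fin 2, (xxzHamiltonian 1 (torusGraph 3 L) (-1) 0 -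
        (μ : ℂ) • totalSpin 1 2).groundStateFunctional
        (siteSpin 1 x (Fin.castSucc α) * siteSpin 1 y (Fin.castSucc α))).re)) (2 * k) x y) /
      ((halfOpenBox 3 (2 * k)).card : ℝ) ^ 2 with hf
  have hbd : ∀ k, f k ≤ 1 / 2 := fun k => orderParam_le_half μ k
  set c' : ℝ := c * a₀ with hc'
  have hc'pos : 0 < c' := by positivity
  suffices hev : ∀ᶠ k : ℕ in Filter.atTop, c' ≤ f k from
    hc'pos.trans_le (Filter.le_liminf_of_le (Filter.isCoboundedUnder_ge_of_le Filter.atTop hbd) hev)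
  filter_upwards [Filter.eventually_ge_atTop (max k₀ (max 2 L₂))] with k hk
  have hk₀ : k₀ ≤ k := le_trans (le_max_left _ _) hk
  have hk2 : 2 ≤ k := le_trans (le_trans (le_max_left _ _) (le_max_right _ _)) hk
  have hkL₂ : L₂ ≤ 2 * k := le_trans (le_trans (le_max_right _ _) (le_max_right _ _)) hk |>.trans
    (by omega)
  have hL0 : 2 * k ≠ 0 := by omega
  haveI : NeZero (2 * k) := ⟨hL0⟩
  have hL3 : 3 ≤ 2 * k := by omega
  have hEven : Even (2 * k) := even_two_mul k
  -- notation
  set L : ℕ := 2 * k with hLdef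
  set V : ℝ := (L : ℝ) ^ 3 with hVdef
  have hVpos : 0 < V := by positivity
  set O : Op (TorusSite 3 L) 2 := ∑ x : TorusSite 3 L, ∑ y : TorusSite 3 L, hop x y with hO
  -- columns of `P₀(H_{L,μ'})`, `|μ'| ≤ ½`: sector ground vectors in a sector of the window
  have hcol : ∀ μ' : ℝ, |μ'| ≤ 1 / 2 → ∀ σ : TensorIndex (TorusSite 3 L) 2,
      (Hmu L μ').groundProj.col σ ≠ 0 →
      ∃ N : ℕ, V / 5 ≤ (N : ℝ) ∧ (N : ℝ) ≤ 4 / 5 * V ∧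
        (totalSpin 1 2 : Op (TorusSite 3 L) 2) *ᵥ (Hmu L μ').groundProj.col σ =
          (((((N : ℕ) : ℝ) - (L : ℝ) ^ 3 / 2 : ℝ)) : ℂ) • (Hmu L μ').groundProj.col σ ∧
        xyTorus 3 L 1 *ᵥ (Hmu L μ').groundProj.col σ = ((lowestEnergyInSector 1 (xyTorus 3 L 1)
          (((N : ℕ) : ℝ) - (L : ℝ) ^ 3 / 2) : ℝ) : ℂ) • (Hmu L μ').groundProj.col σ := by
    intro μ' hμ'abs σ hv0
    set v := (Hmu L μ').groundProj.col σ with hvdef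
    obtain ⟨hvmem, hS3⟩ := col_facts L hL3 μ' σ
    set M : ℝ := (L : ℝ) ^ 3 / 2 - (downCount σ : ℝ) with hM
    have hwin := sector_window L hL3 hμ'abs hvmem hS3 hv0
    have hj : downCount σ ≤ L ^ 3 := by
      have h1 : downCount σ ≤ Fintype.card (TorusSite 3 L) := Finset.card_filter_le _ _ |>.trans
        (by rw [Finset.card_univ])
      have h2 : Fintype.card (TorusSite 3 L) = L ^ 3 := by simp [ZMod.card, Fintype.card_fin]
      omega
    have hMeq : ((L ^ 3 - downCount σ : ℕ) : ℝ) - (L : ℝ) ^ 3 / 2 = M := by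
      rw [Nat.cast_sub hj]
      push_cast
      rw [hM]
      ring
    refine ⟨L ^ 3 - downCount σ, ?_, ?_, ?_, ?_⟩
    · rw [Nat.cast_sub hj]
      push_cast
      rw [abs_le] at hwin
      obtain ⟨h1, h2⟩ := hwin
      rw [hVdef]
      linarith
    · rw [Nat.cast_sub hj]
      push_cast
      rw [abs_le] at hwin
      obtain ⟨h1, h2⟩ := hwin
      rw [hVdef]
      linarith
    · rw [hMeq]
      exact hS3
    · rw [hMeq]
      exact stub_sectorGround L μ' M v hvmem hS3 hv0
  -- the anchor at `μ = 0`
  obtain ⟨σ', hσ'0, hσ'⟩ := hanchor k hk₀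
  obtain ⟨N', hN'lo, hN'hi, hS', hH'⟩ := hcol 0 (by norm_num) σ' hσ'0
  set v' := (Hmu L 0).groundProj.col σ' with hv'def
  have n'pos := normSq_pos_of_ne_zero hσ'0
  have hcast : (((2 * k : ℕ) : ℝ) ^ 3) = V := by rw [hVdef]
  rw [hcast] at hσ'
  have hratio' : a₀ * V ^ 2 ≤ (star v' ⬝ᵥ O *ᵥ v').re / (star v' ⬝ᵥ v').re := by
    rw [le_div_iff₀ n'pos]
    exact hσ'
  -- the k-th term
  show c' ≤ f k
  rw [hf]
  simp only []
  rw [orderParam_eq_re_gsf μ hk2]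
  rw [le_div_iff₀ (by positivity)]
  rw [hcast]
  refine stub_average (Hmu_isHermitian L μ) O (c' * V ^ 2) fun σ hσ0 => ?_
  obtain ⟨N, hNlo, hNhi, hS, hH⟩ := hcol μ hμ' σ hσ0
  set v := (Hmu L μ).groundProj.col σ with hvdef
  have npos := normSq_pos_of_ne_zero hσ0
  have key := hcomp L hkL₂ hEven N N' (by rw [hVdef] at hNlo; exact hNlo)
    (by rw [hVdef] at hNhi; exact hNhi) (by rw [hVdef] at hN'lo; exact hN'lo)
    (by rw [hVdef] at hN'hi; exact hN'hi) v v' hσ0 hS hH hσ'0 hS' hH'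
  have hratio : (star v ⬝ᵥ O *ᵥ v).re / (star v ⬝ᵥ v).re * (star v ⬝ᵥ v).re =
      (star v ⬝ᵥ O *ᵥ v).re := div_mul_cancel₀ _ npos.ne'
  calc c' * V ^ 2 * (star v ⬝ᵥ v).re = c * (a₀ * V ^ 2) * (star v ⬝ᵥ v).re := by rw [hc']; ring
    _ ≤ c * ((star v' ⬝ᵥ O *ᵥ v').re / (star v' ⬝ᵥ v').re) * (star v ⬝ᵥ v).re :=
        mul_le_mul_of_nonneg_right (mul_le_mul_of_nonneg_left hratio' hc.le) npos.le
    _ ≤ (star v ⬝ᵥ O *ᵥ v).re / (star v ⬝ᵥ v).re * (star v ⬝ᵥ v).re :=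
        mul_le_mul_of_nonneg_right key npos.le
    _ = (star v ⬝ᵥ O *ᵥ v).re := hratio

/-- **Concavity implies comparability (constant `¼`)**: if the planar-moment profile of the sector ground vectors is
concave on `[1, L³ − 1]`, then `a(ψ) ≥ ¼ a(ψ')` for sector ground vectors in any two sectors `N, N' ∈ [L³/5, 4L³/5]`
(Perron–Frobenius makes the profile a function of `N`, `SectorGroundStatePerron_proof`; tent bound `stub_tent`;
`min (N/N', (L³−N)/(L³−N')) ≥ ¼` on the window). [folklore] -/
theorem comparable_of_concave
    (hconcave : ∃ L₀ : ℕ, ∀ (L : ℕ) [NeZero L], L₀ ≤ L → Even L → ∀ N : ℕ, 1 ≤ N → N + 1 ≤ L ^ 3 →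
        ∀ ψm ψ0 ψp : TensorIndex (TorusSite 3 L) 2 → ℂ,
          ψm ≠ 0 → (totalSpin 1 2 : Op (TorusSite 3 L) 2) *ᵥ ψm =
              (((((N - 1 : ℕ) : ℝ) - (L : ℝ) ^ 3 / 2 : ℝ)) : ℂ) • ψm →
            xyTorus 3 L 1 *ᵥ ψm = ((lowestEnergyInSector 1 (xyTorus 3 L 1)
              (((N - 1 : ℕ) : ℝ) - (L : ℝ) ^ 3 / 2) : ℝ) : ℂ) • ψm →
          ψ0 ≠ 0 → (totalSpin 1 2 : Op (TorusSite 3 L) 2) *ᵥ ψ0 =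
              ((((N : ℝ) - (L : ℝ) ^ 3 / 2 : ℝ)) : ℂ) • ψ0 →
            xyTorus 3 L 1 *ᵥ ψ0 = ((lowestEnergyInSector 1 (xyTorus 3 L 1)
              ((N : ℝ) - (L : ℝ) ^ 3 / 2) : ℝ) : ℂ) • ψ0 →
          ψp ≠ 0 → (totalSpin 1 2 : Op (TorusSite 3 L) 2) *ᵥ ψp =
              (((((N + 1 : ℕ) : ℝ) - (L : ℝ) ^ 3 / 2 : ℝ)) : ℂ) • ψp →
            xyTorus 3 L 1 *ᵥ ψp = ((lowestEnergyInSector 1 (xyTorus 3 L 1)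
              (((N + 1 : ℕ) : ℝ) - (L : ℝ) ^ 3 / 2) : ℝ) : ℂ) • ψp →
          (star ψp ⬝ᵥ (∑ x : TorusSite 3 L, ∑ y : TorusSite 3 L, hop x y) *ᵥ ψp).re /
              (star ψp ⬝ᵥ ψp).re +
            (star ψm ⬝ᵥ (∑ x : TorusSite 3 L, ∑ y : TorusSite 3 L, hop x y) *ᵥ ψm).re /
              (star ψm ⬝ᵥ ψm).re ≤
            2 * ((star ψ0 ⬝ᵥ (∑ x : TorusSite 3 L, ∑ y : TorusSite 3 L, hop x y) *ᵥ ψ0).re /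
              (star ψ0 ⬝ᵥ ψ0).re)) :
    ∃ c : ℝ, 0 < c ∧ ∃ L₀ : ℕ, ∀ (L : ℕ) [NeZero L], L₀ ≤ L → Even L → ∀ N N' : ℕ,
        (L : ℝ) ^ 3 / 5 ≤ N → (N : ℝ) ≤ 4 / 5 * (L : ℝ) ^ 3 →
        (L : ℝ) ^ 3 / 5 ≤ N' → (N' : ℝ) ≤ 4 / 5 * (L : ℝ) ^ 3 →
        ∀ ψ ψ' : TensorIndex (TorusSite 3 L) 2 → ℂ,
          ψ ≠ 0 → (totalSpin 1 2 : Op (TorusSite 3 L) 2) *ᵥ ψ =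
              (((((N : ℕ) : ℝ) - (L : ℝ) ^ 3 / 2 : ℝ)) : ℂ) • ψ →
            xyTorus 3 L 1 *ᵥ ψ = ((lowestEnergyInSector 1 (xyTorus 3 L 1)
              (((N : ℕ) : ℝ) - (L : ℝ) ^ 3 / 2) : ℝ) : ℂ) • ψ →
          ψ' ≠ 0 → (totalSpin 1 2 : Op (TorusSite 3 L) 2) *ᵥ ψ' =
              (((((N' : ℕ) : ℝ) - (L : ℝ) ^ 3 / 2 : ℝ)) : ℂ) • ψ' →
            xyTorus 3 L 1 *ᵥ ψ' = ((lowestEnergyInSector 1 (xyTorus 3 L 1)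
              (((N' : ℕ) : ℝ) - (L : ℝ) ^ 3 / 2) : ℝ) : ℂ) • ψ' →
          c * ((star ψ' ⬝ᵥ (∑ x : TorusSite 3 L, ∑ y : TorusSite 3 L, hop x y) *ᵥ ψ').re /
              (star ψ' ⬝ᵥ ψ').re) ≤
            (star ψ ⬝ᵥ (∑ x : TorusSite 3 L, ∑ y : TorusSite 3 L, hop x y) *ᵥ ψ).re /
              (star ψ ⬝ᵥ ψ).re := by
  obtain ⟨L₁, hconc⟩ := hconcave
  refine ⟨1 / 4, by norm_num, max L₁ 2, ?_⟩
  intro L _ hL hEven N N' hNlo hNhi hN'lo hN'hi φ φ' hφ0 hφS hφH hφ'0 hφ'S hφ'H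
  have hkL₁ : L₁ ≤ L := le_trans (le_max_left _ _) hL
  have hL2 : 2 ≤ L := le_trans (le_max_right _ _) hL
  set V : ℝ := (L : ℝ) ^ 3 with hVdef
  have hVpos : 0 < V := by positivity
  set O : Op (TorusSite 3 L) 2 := ∑ x : TorusSite 3 L, ∑ y : TorusSite 3 L, hop x y with hO
  -- the Perron–Frobenius family of sector ground vectors and the profile `a`
  have hPF := fun (N : ℕ) (hN : N ≤ L ^ 3) =>
    Summit.AtomisticToContinuum.BoseEinsteinCondensation.Theorems.SectorGroundStatePerron_proof
      3 L (by norm_num) hL2 N hN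
  choose ψ hψ0 hψnn hψK hψH hψuniq using hPF
  let a : ℕ → ℝ := fun N => if hN : N ≤ L ^ 3 then
    (star (ψ N hN) ⬝ᵥ O *ᵥ (ψ N hN)).re / (star (ψ N hN) ⬝ᵥ (ψ N hN)).re else 0
  have ha_def : ∀ N (hN : N ≤ L ^ 3), a N =
      (star (ψ N hN) ⬝ᵥ O *ᵥ (ψ N hN)).re / (star (ψ N hN) ⬝ᵥ (ψ N hN)).re := fun N hN => by
    simp only [a, dif_pos hN]
  have ha_nn : ∀ N, N ≤ L ^ 3 → 0 ≤ a N := fun N hN => by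
    rw [ha_def N hN]
    exact div_nonneg (re_quad_sumHop_nonneg _) (normSq_pos_of_ne_zero (hψ0 N hN)).le
  -- any sector ground vector has planar moment ratio `a N`
  have ha_val : ∀ N (hN : N ≤ L ^ 3) (v : TensorIndex (TorusSite 3 L) 2 → ℂ), v ≠ 0 →
      (totalSpin 1 2 : Op (TorusSite 3 L) 2) *ᵥ v = ((((N : ℝ) - (L : ℝ) ^ 3 / 2 : ℝ)) : ℂ) • v →
      xyTorus 3 L 1 *ᵥ v = ((lowestEnergyInSector 1 (xyTorus 3 L 1)
        ((N : ℝ) - (L : ℝ) ^ 3 / 2) : ℝ) : ℂ) • v →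
      (star v ⬝ᵥ O *ᵥ v).re / (star v ⬝ᵥ v).re = a N := by
    intro N hN v hv0 hvS hvH
    obtain ⟨c', hc'⟩ := hψuniq N hN v ((mem_spinZSector_iff L _ _).mpr hvS) hvH
    rw [ha_def N hN, re_quad_eq_ratio_mul O (hψ0 N hN) hc', mul_div_assoc,
      div_self (normSq_pos_of_ne_zero hv0).ne', mul_one]
  -- concavity of the profile
  have ha_conc : ∀ n : ℕ, 1 ≤ n → n + 1 ≤ L ^ 3 → a (n + 1) + a (n - 1) ≤ 2 * a n := by
    intro n hn1 hn2
    have hnm : n - 1 ≤ L ^ 3 := by omega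
    have hn0 : n ≤ L ^ 3 := by omega
    rw [ha_def (n + 1) hn2, ha_def (n - 1) hnm, ha_def n hn0]
    exact hconc L hkL₁ hEven n hn1 hn2 (ψ (n - 1) hnm) (ψ n hn0) (ψ (n + 1) hn2)
      (hψ0 _ _) ((mem_spinZSector_iff L _ _).mp (hψK _ _)) (hψH _ _)
      (hψ0 _ _) ((mem_spinZSector_iff L _ _).mp (hψK _ _)) (hψH _ _)
      (hψ0 _ _) ((mem_spinZSector_iff L _ _).mp (hψK _ _)) (hψH _ _)
  -- the two sectors
  have hNle : N ≤ L ^ 3 := by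
    have : (N : ℝ) ≤ (L : ℝ) ^ 3 := by rw [hVdef] at hNhi; linarith
    exact_mod_cast this
  have hN'le : N' ≤ L ^ 3 := by
    have : (N' : ℝ) ≤ (L : ℝ) ^ 3 := by rw [hVdef] at hN'hi; linarith
    exact_mod_cast this
  have hN'pos : 0 < N' := by
    have : (0 : ℝ) < N' := by rw [hVdef] at hN'lo; linarith
    exact_mod_cast this
  have hN'lt : N' < L ^ 3 := by
    have : (N' : ℝ) < (L : ℝ) ^ 3 := by rw [hVdef] at hN'hi; linarith
    exact_mod_cast this
  rw [ha_val N hNle φ hφ0 hφS hφH, ha_val N' hN'le φ' hφ'0 hφ'S hφ'H]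
  -- tent
  have htent := stub_tent (L ^ 3) a ha_conc ha_nn N N' hN'pos hN'lt hNle
  have hVnat : ((L ^ 3 : ℕ) : ℝ) = V := by rw [hVdef]; push_cast; ring
  rw [hVnat] at htent
  have hmin : (1 / 4 : ℝ) ≤ min ((N : ℝ) / N') ((V - N) / (V - N')) := by
    refine le_min ?_ ?_
    · rw [le_div_iff₀ (by exact_mod_cast hN'pos)]
      rw [hVdef] at hNlo hN'hi
      linarith
    · have hpos : 0 < V - N' := by rw [hVdef] at hN'hi ⊢; linarith
      rw [le_div_iff₀ hpos]
      rw [hVdef] at hNhi hN'lo ⊢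
      linarith
  have haN'nn : 0 ≤ a N' := ha_nn N' hN'le
  calc 1 / 4 * a N' = a N' * (1 / 4) := by ring
    _ ≤ a N' * min ((N : ℝ) / N') ((V - N) / (V - N')) := mul_le_mul_of_nonneg_left hmin haN'nn
    _ ≤ a N := htent

/-- **Concavity of the planar moment along the filling ladder implies ODLRO off half filling**
(`μ₀ = ½`, liminf bound `a₀/4` with `a₀` the KLS anchor constant). The hypothesis is verbatim the line's registered
stub `stub_concave`. [folklore] -/
theorem LatticeODLROOffHalfFilling_of_concave
    (hconcave : ∃ L₀ : ℕ, ∀ (L : ℕ) [NeZero L], L₀ ≤ L → Even L → ∀ N : ℕ, 1 ≤ N → N + 1 ≤ L ^ 3 →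
        ∀ ψm ψ0 ψp : TensorIndex (TorusSite 3 L) 2 → ℂ,
          ψm ≠ 0 → (totalSpin 1 2 : Op (TorusSite 3 L) 2) *ᵥ ψm =
              (((((N - 1 : ℕ) : ℝ) - (L : ℝ) ^ 3 / 2 : ℝ)) : ℂ) • ψm →
            xyTorus 3 L 1 *ᵥ ψm = ((lowestEnergyInSector 1 (xyTorus 3 L 1)
              (((N - 1 : ℕ) : ℝ) - (L : ℝ) ^ 3 / 2) : ℝ) : ℂ) • ψm →
          ψ0 ≠ 0 → (totalSpin 1 2 : Op (TorusSite 3 L) 2) *ᵥ ψ0 =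
              ((((N : ℝ) - (L : ℝ) ^ 3 / 2 : ℝ)) : ℂ) • ψ0 →
            xyTorus 3 L 1 *ᵥ ψ0 = ((lowestEnergyInSector 1 (xyTorus 3 L 1)
              ((N : ℝ) - (L : ℝ) ^ 3 / 2) : ℝ) : ℂ) • ψ0 →
          ψp ≠ 0 → (totalSpin 1 2 : Op (TorusSite 3 L) 2) *ᵥ ψp =
              (((((N + 1 : ℕ) : ℝ) - (L : ℝ) ^ 3 / 2 : ℝ)) : ℂ) • ψp →
            xyTorus 3 L 1 *ᵥ ψp = ((lowestEnergyInSector 1 (xyTorus 3 L 1)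
              (((N + 1 : ℕ) : ℝ) - (L : ℝ) ^ 3 / 2) : ℝ) : ℂ) • ψp →
          (star ψp ⬝ᵥ (∑ x : TorusSite 3 L, ∑ y : TorusSite 3 L, hop x y) *ᵥ ψp).re /
              (star ψp ⬝ᵥ ψp).re +
            (star ψm ⬝ᵥ (∑ x : TorusSite 3 L, ∑ y : TorusSite 3 L, hop x y) *ᵥ ψm).re /
              (star ψm ⬝ᵥ ψm).re ≤
            2 * ((star ψ0 ⬝ᵥ (∑ x : TorusSite 3 L, ∑ y : TorusSite 3 L, hop x y) *ᵥ ψ0).re /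
              (star ψ0 ⬝ᵥ ψ0).re)) :
    Summit.AtomisticToContinuum.BoseEinsteinCondensation.Theses.BECGroundStateSOS.LatticeODLROOffHalfFilling :=
  LatticeODLROOffHalfFilling_of_comparable (comparable_of_concave hconcave)

end Summit.AtomisticToContinuum.BoseEinsteinCondensation.Theorems.LatticeODLROOffHalfFilling.Ladder

end
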